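import Literature.NumberTheory.BeurlingPrimes.BDRMultisetTemplate
import HarnessLib

/-!
# `Σ_k F(x^{1/k})/k = G(x)` for the BDR template, and the density comparison `0 ≤ G′ − F′ ≤ K u^{−1/2}`

Topic `Literature/NumberTheory/BeurlingPrimes`, grouping namespace `BDRMultiset`. Everything in this file is PROVED.

Broucke–Debruyne–Révész (2023), proof of Theorem 3.2: "`G(x) := Σ_{k=1}^∞ (1/k) F(x^{1/k}) = Li(x) + Σ_ω Li(x^ω) −
Σ_ρ Li(x^ρ) + M Li(x^δ)` … the latter equality holds in view of (2.3) and (3.1)" and "we exploit the monotonicity of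
… `G(x) − F(x)` and the standard estimate … `G(x) − F(x) = Σ_{k≥2} F(x^{1/k})/k ≪ x^{1/2}`". For the real-part
template of `BDRMultisetTemplate.lean` we prove:

* `hasSum_logSeries_div` — the coefficient-level Fubini identity: for `|c n| ≤ B Qⁿ`, `c 0 = 0`, `L ≥ 0`,
  **`Σ_{k≥1} (1/k) logSeries (n ↦ c n/ζ(n+1)) (L/k) = logSeries c L`** (absolute convergence and `ζ(n+1) · 1/ζ(n+1) = 1`;
  the tree's `hasSum_li_rpow_div` is the case `c n = 1/n`);
* `hasSum_tmplF_rpow_div` — **`Σ_{k≥1} F(x^{1/k})/k = G(x)`** (`x ≥ 1`), and `hasSum_NF_div` — `Σ_{k≥1} NF(L/k)/k = NG(L)`,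
  i.e. `x log x (G′ − F′)(x) = Σ_{k≥2} NF(log x/k)/k`;
* `densG_sub_densF_bounds` — if `NF ≥ 0` on `(0,∞)` (Lemma 3.1) then **`0 ≤ g(u) − f(u) ≤ C₅ u^{−1/2}`** for `u > 1`, with
  `C₅` explicit (`NF(L′) ≤ C₅ L′ e^{L′}`, `Σ_{k≥2} k^{−2} ≤ 1`): the hypothesis `hgf` of the tree's `BV.norm_Z_le` /
  `BV.zeta_eq_exp_mul_exp_Z` (`BVContinuation.lean`) for the template pair `(f, g) = (F′, G′)`.

## References
* [BrouckeDebruyneRevesz2023] F. Broucke, G. Debruyne, Sz. Gy. Révész, *Some examples of well-behaved Beurling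
  number systems*, arXiv:2309.01567, proof of Theorem 3.2 ((3.3) and the estimates for `G − F`) (read).
-/

noncomputable section

open Filter Topology Complex Set
open scoped Nat

namespace Literature.NumberTheory.BeurlingPrimes

/-! ### The coefficient-level Fubini identity -/

/-- `invZetaCoeff n · zetaN (n+1) = 1` for `n ≥ 1`. [folklore] -/
theorem invZetaCoeff_mul_zetaN {n : ℕ} (hn : n ≠ 0) : invZetaCoeff n * zetaN (n + 1) = 1 := by
  rw [invZetaCoeff, if_neg hn, inv_mul_cancel₀ (zetaN_pos (by omega)).ne']

/-- **`Σ_{k≥0} (1/(k+1)) logSeries (n ↦ c n/ζ(n+1)) (L/(k+1)) = logSeries c L`** for `|c n| ≤ B Qⁿ`, `c 0 = 0`,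
`L ≥ 0`: rearrangement of the absolutely convergent double series `Σ_{n,k} c n Lⁿ (k+1)^{−(n+1)}/(n! ζ(n+1))`, using
`Σ_k (k+1)^{−(n+1)} = ζ(n+1)`. [cite: BrouckeDebruyneRevesz2023, proof of Theorem 3.2 (3.3)] -/
theorem hasSum_logSeries_div {c : ℕ → ℝ} {B Q : ℝ} (hB : 0 ≤ B) (hc : ∀ n, |c n| ≤ B * Q ^ n) (hc0 : c 0 = 0)
    {L : ℝ} (hL : 0 ≤ L) :
    HasSum (fun k : ℕ ↦ logSeries (fun n ↦ invZetaCoeff n * c n) (L / (k + 1)) / (k + 1)) (logSeries c L) := by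
  -- the double family and its absolute value
  set G : ℕ → ℕ → ℝ := fun n k ↦ invZetaCoeff n * c n * L ^ n / n ! * (1 / ((k + 1 : ℕ) : ℝ) ^ (n + 1)) with hG
  set G' : ℕ → ℕ → ℝ := fun n k ↦ invZetaCoeff n * |c n| * L ^ n / n ! * (1 / ((k + 1 : ℕ) : ℝ) ^ (n + 1)) with hG'
  have hG'0 : ∀ n k, 0 ≤ G' n k := fun n k ↦ by
    have := invZetaCoeff_nonneg n; simp only [hG']; positivity
  have habs : ∀ n k, |G n k| = G' n k := fun n k ↦ by
    simp only [hG, hG', abs_mul, abs_div, abs_of_nonneg (invZetaCoeff_nonneg n), abs_pow, abs_of_nonneg hL,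
      Nat.abs_cast, abs_of_nonneg (show (0:ℝ) ≤ 1 / ((k + 1 : ℕ) : ℝ) ^ (n + 1) by positivity)]
  -- inner sums over `k`
  have hinner : ∀ n, HasSum (fun k ↦ G n k) (c n * L ^ n / n !) := by
    intro n
    rcases Nat.eq_zero_or_pos n with rfl | hn
    · have h0 : (fun k ↦ G 0 k) = fun _ ↦ 0 := by funext k; simp [hG, invZetaCoeff]
      rw [h0, hc0]; simp [hasSum_zero]
    · have hs := summable_one_div_succ_pow (by omega : 2 ≤ n + 1)
      have h := (hs.hasSum).mul_left (invZetaCoeff n * c n * L ^ n / n !)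
      have hval : invZetaCoeff n * c n * L ^ n / n ! * zetaN (n + 1) = c n * L ^ n / n ! := by
        have := invZetaCoeff_mul_zetaN hn.ne'
        calc _ = (invZetaCoeff n * zetaN (n + 1)) * (c n * L ^ n / n !) := by ring
          _ = _ := by rw [this, one_mul]
      rw [zetaN] at hval
      rw [← hval]
      exact h
  have hinner' : ∀ n, HasSum (fun k ↦ G' n k) (|c n| * L ^ n / n !) := by
    intro n
    rcases Nat.eq_zero_or_pos n with rfl | hn
    · have h0 : (fun k ↦ G' 0 k) = fun _ ↦ 0 := by funext k; simp [hG', invZetaCoeff]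
      rw [h0, hc0]; simp [hasSum_zero]
    · have hs := summable_one_div_succ_pow (by omega : 2 ≤ n + 1)
      have h := (hs.hasSum).mul_left (invZetaCoeff n * |c n| * L ^ n / n !)
      have hval : invZetaCoeff n * |c n| * L ^ n / n ! * zetaN (n + 1) = |c n| * L ^ n / n ! := by
        have := invZetaCoeff_mul_zetaN hn.ne'
        calc _ = (invZetaCoeff n * zetaN (n + 1)) * (|c n| * L ^ n / n !) := by ring
          _ = _ := by rw [this, one_mul]
      rw [zetaN] at hval
      rw [← hval]
      exact h
  -- summability of `uncurry G'` (non-negative) hence of `uncurry G`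
  have hsumm_n' : Summable fun n ↦ |c n| * L ^ n / n ! := by
    have := summable_logSeries_abs hB hc L
    refine this.congr fun n ↦ ?_
    rw [abs_div, abs_mul, abs_pow, abs_of_nonneg hL, Nat.abs_cast]
  have hF' : Summable (Function.uncurry G') := by
    refine (summable_prod_of_nonneg fun p ↦ hG'0 p.1 p.2).mpr ⟨fun n ↦ (hinner' n).summable, ?_⟩
    exact hsumm_n'.congr fun n ↦ ((hinner' n).tsum_eq).symm
  have hF : Summable (Function.uncurry G) := by
    refine Summable.of_norm ?_
    refine hF'.congr fun p ↦ ?_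
    rw [Function.uncurry, Function.uncurry, Real.norm_eq_abs, habs]
  have hFval : HasSum (Function.uncurry G) (logSeries c L) := by
    have h1 : ∑' p, Function.uncurry G p = ∑' n, ∑' k, G n k := hF.tsum_prod' fun n ↦ (hinner n).summable
    have h2 : ∑' n, ∑' k, G n k = logSeries c L := by
      rw [logSeries]; exact tsum_congr fun n ↦ (hinner n).tsum_eq
    rw [← h2, ← h1]
    exact hF.hasSum
  -- swap and identify fibres over `k`
  have hswap : HasSum ((Function.uncurry G) ∘ (Equiv.prodComm ℕ ℕ)) (logSeries c L) :=
    (Equiv.prodComm ℕ ℕ).hasSum_iff.mpr hFval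
  refine hswap.prod_fiberwise fun k ↦ ?_
  have hk : (0 : ℝ) < (k : ℝ) + 1 := by positivity
  have hcoef : ∀ n, |invZetaCoeff n * c n| ≤ B * Q ^ n := fun n ↦ by
    rw [abs_mul]
    calc |invZetaCoeff n| * |c n| ≤ 1 * (B * Q ^ n) :=
          mul_le_mul (abs_invZetaCoeff_le_one n) (hc n) (abs_nonneg _) zero_le_one
      _ = _ := one_mul _
  have h := (hasSum_logSeries hB hcoef (L / (k + 1))).div_const ((k : ℝ) + 1)
  have hfun : ∀ n, (Function.uncurry G ∘ (Equiv.prodComm ℕ ℕ)) (k, n) =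
      invZetaCoeff n * c n * (L / (k + 1)) ^ n / n ! / (k + 1) := by
    intro n
    simp only [Function.comp_apply, Equiv.prodComm_apply, Prod.swap_prod_mk, Function.uncurry_apply_pair, hG]
    push_cast
    rw [div_pow]
    field_simp
    ring
  simp_rw [hfun]
  exact h

namespace BDRMultiset

variable {R S : Multiset ℂ} {δ : ℝ} {M : ℕ}

/-- `cF n = invZetaCoeff n · cG n`. [folklore] -/
theorem cF_eq (n : ℕ) : cF R S δ M n = invZetaCoeff n * cG R S δ M n := by
  unfold cF cG; split_ifs <;> ring

/-- `cNF n = invZetaCoeff n · cNG n`. [folklore] -/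
theorem cNF_eq (n : ℕ) : cNF R S δ M n = invZetaCoeff n * cNG R S δ M n := by
  unfold cNF cNG; split_ifs with h
  · simp [h, invZetaCoeff]
  · rfl

/-- `F(x^{1/(k+1)}) = logSeries cF (log x/(k+1))` for `x ≥ 1`. [cite: BrouckeDebruyneRevesz2023, proof of Theorem 3.2] -/
theorem tmplF_rpow_eq {x : ℝ} (hx : 1 ≤ x) (k : ℕ) :
    tmplF R S δ M (x ^ (1 / ((k : ℝ) + 1))) = logSeries (cF R S δ M) (Real.log x / (k + 1)) := by
  have hx0 : 0 < x := lt_of_lt_of_le one_pos hx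
  have h1 : 1 ≤ x ^ (1 / ((k : ℝ) + 1)) := Real.one_le_rpow hx (by positivity)
  rw [tmplF_of_one_le h1, Real.log_rpow hx0]
  congr 1
  field_simp

/-- **`Σ_{k≥1} F(x^{1/k})/k = G(x)`** for `x ≥ 1` (`0 ≤ δ ≤ 1`): the defining relation between the template and its
companion (BDR (3.3): "`G(x) := Σ_k (1/k) F(x^{1/k}) = Li(x) + Σ Li(x^ω) − Σ Li(x^ρ) + M Li(x^δ)`").
[cite: BrouckeDebruyneRevesz2023, proof of Theorem 3.2 (3.3)] -/
theorem hasSum_tmplF_rpow_div (hδ : 0 ≤ δ) (hδ1 : δ ≤ 1) {x : ℝ} (hx : 1 ≤ x) :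
    HasSum (fun k : ℕ ↦ tmplF R S δ M (x ^ (1 / ((k : ℝ) + 1))) / (k + 1)) (tmplG R S δ M x) := by
  have h := hasSum_logSeries_div sizeBound_nonneg (abs_cG_le (R := R) (S := S) (M := M) hδ hδ1) (by simp [cG])
    (Real.log_nonneg hx)
  rw [tmplG_of_one_le hx]
  have heq : (fun n ↦ invZetaCoeff n * cG R S δ M n) = cF R S δ M := funext fun n ↦ (cF_eq n).symm
  rw [heq] at h
  simp_rw [tmplF_rpow_eq hx]
  exact h

/-- **`Σ_{k≥1} NF(L/k)/k = NG(L)`** for `L ≥ 0` (`0 ≤ δ ≤ 1`): `x log x` times the derivative of the previous identity.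
[cite: BrouckeDebruyneRevesz2023, proof of Theorem 3.2] -/
theorem hasSum_NF_div (hδ : 0 ≤ δ) (hδ1 : δ ≤ 1) {L : ℝ} (hL : 0 ≤ L) :
    HasSum (fun k : ℕ ↦ NF R S δ M (L / (k + 1)) / (k + 1)) (NG R S δ M L) := by
  have h := hasSum_logSeries_div sizeBound_nonneg (abs_cNG_le (R := R) (S := S) (M := M) hδ hδ1) (by simp [cNG]) hL
  have heq : (fun n ↦ invZetaCoeff n * cNG R S δ M n) = cNF R S δ M := funext fun n ↦ (cNF_eq n).symm
  rw [heq] at h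
  exact h

/-- **`NG(L) − NF(L) = Σ_{k≥1} NF(L/(k+1))/(k+1)`** (`L ≥ 0`). [cite: BrouckeDebruyneRevesz2023, proof of Theorem 3.2] -/
theorem hasSum_NF_div_tail (hδ : 0 ≤ δ) (hδ1 : δ ≤ 1) {L : ℝ} (hL : 0 ≤ L) :
    HasSum (fun k : ℕ ↦ NF R S δ M (L / (k + 2)) / (k + 2)) (NG R S δ M L - NF R S δ M L) := by
  have h := (hasSum_nat_add_iff' 1).mpr (hasSum_NF_div (R := R) (S := S) (M := M) hδ hδ1 hL)
  simp only [Finset.range_one, Finset.sum_singleton, Nat.cast_zero, zero_add, div_one] at h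
  refine h.congr_fun fun k ↦ ?_
  push_cast
  ring_nf

/-! ### The density comparison `0 ≤ g − f ≤ C₅ u^{−1/2}` -/

/-- `NF(L′) ≤ C₅ L′ e^{L′}` for all `L′ ≥ 0`, `C₅ = BQe^Q + C_F` (near `0` from `|NF| ≤ B(e^{QL′}−1)`, away from `0`
from `NF(log y) ≤ C_F y`). [folklore] -/
theorem NF_le_mul_exp (hS : ∀ ω ∈ S, ω.re ≤ 1) (hR : ∀ ρ ∈ R, ρ.re ≤ 1) (hδ : 0 ≤ δ) (hδ1 : δ ≤ 1) {L : ℝ}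
    (hL : 0 ≤ L) :
    NF R S δ M L ≤ (sizeBound R S M * normBound R S * Real.exp (normBound R S) +
      (1 + (3 + 2 * Hc R S) * (1 + Multiset.card S + Multiset.card R) + M)) * (L * Real.exp L) := by
  set B := sizeBound R S M
  set Q := normBound R S
  set CF : ℝ := 1 + (3 + 2 * Hc R S) * (1 + Multiset.card S + Multiset.card R) + M with hCF
  have hB : 0 ≤ B := sizeBound_nonneg
  have hQ : 0 ≤ Q := normBound_nonneg
  have hH := one_le_Hc R S
  have hCF0 : 0 ≤ CF := by positivity
  have hC1 : 0 ≤ B * Q * Real.exp Q := by positivity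
  rcases le_or_gt L 1 with hL1 | hL1
  · -- `L ≤ 1`: `NF ≤ B(e^{QL} − 1) ≤ BQLe^{QL} ≤ BQe^Q · L ≤ BQe^Q L e^L`
    have h1 := abs_NF_le (R := R) (S := S) (M := M) hδ hδ1 L
    rw [abs_of_nonneg hL] at h1
    have h2 : Real.exp (Q * L) - 1 ≤ Q * L * Real.exp (Q * L) := by
      have h := Real.add_one_le_exp (-(Q * L))
      have he := Real.exp_pos (Q * L)
      have : Real.exp (-(Q * L)) * Real.exp (Q * L) = 1 := by rw [← Real.exp_add]; simp
      nlinarith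
    have h3 : Real.exp (Q * L) ≤ Real.exp Q := Real.exp_le_exp.2 (by nlinarith)
    have h4 : 1 ≤ Real.exp L := Real.one_le_exp hL
    calc NF R S δ M L ≤ |NF R S δ M L| := le_abs_self _
      _ ≤ B * (Q * L * Real.exp (Q * L)) := h1.trans (mul_le_mul_of_nonneg_left h2 hB)
      _ ≤ B * (Q * L * Real.exp Q) := by gcongr
      _ = B * Q * Real.exp Q * (L * 1) := by ring
      _ ≤ B * Q * Real.exp Q * (L * Real.exp L) := by gcongr
      _ ≤ (B * Q * Real.exp Q + CF) * (L * Real.exp L) := by nlinarith [mul_nonneg hL (Real.exp_pos L).le]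
  · -- `L > 1`: `NF(L) = NF(log e^L) ≤ C_F e^L ≤ C_F L e^L`
    have hy : 1 ≤ Real.exp L := Real.one_le_exp hL
    have h1 := NF_log_le (M := M) hS hR hδ hδ1 hy
    rw [Real.log_exp] at h1
    calc NF R S δ M L ≤ CF * Real.exp L := h1
      _ = CF * (1 * Real.exp L) := by ring
      _ ≤ CF * (L * Real.exp L) := by gcongr
      _ ≤ (B * Q * Real.exp Q + CF) * (L * Real.exp L) := by nlinarith [mul_nonneg hL (Real.exp_pos L).le]

/-- `Σ_{k≥0} 1/(k+2)² ≤ 1` (`= ζ(2) − 1`). [folklore] -/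
theorem hasSum_inv_sq_tail : ∃ s : ℝ, s ≤ 1 ∧ HasSum (fun k : ℕ ↦ 1 / ((k : ℝ) + 2) ^ 2) s := by
  have hs := summable_one_div_succ_pow (le_refl 2)
  have h := (hasSum_nat_add_iff' 1).mpr hs.hasSum
  simp only [Finset.range_one, Finset.sum_singleton, zero_add, Nat.cast_one, one_pow, div_one] at h
  refine ⟨zetaN 2 - 1, by linarith [zetaN_two_le_two], ?_⟩
  rw [zetaN]
  refine h.congr_fun fun k ↦ ?_
  push_cast; ring_nf

/-- **The density comparison** (hypothesis `hgf` of `BVContinuation.lean`): if `NF ≥ 0` on `(0, ∞)` (BDR Lemma 3.1,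
`M ≥ M₀`) then for `u > 1`, `0 ≤ g(u) − f(u) ≤ C₅ u^{−1/2}` where `g = densG`, `f = densF` and `C₅ = BQe^Q + C_F`
(BDR: "`G(x) − F(x) = Σ_{k≥2} F(x^{1/k})/k ≪ x^{1/2}`", here at the level of densities:
`x log x (g − f)(x) = Σ_{k≥2} NF(log x/k)/k ≤ C₅ √x log x`). [cite: BrouckeDebruyneRevesz2023, proof of Theorem 3.2] -/
theorem densG_sub_densF_bounds (hS : ∀ ω ∈ S, ω.re ≤ 1) (hR : ∀ ρ ∈ R, ρ.re ≤ 1) (hδ : 0 ≤ δ) (hδ1 : δ ≤ 1)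
    (hpos : ∀ L : ℝ, 0 < L → 0 ≤ NF R S δ M L) {u : ℝ} (hu : 1 < u) :
    0 ≤ densG R S δ M u - densF R S δ M u ∧
      densG R S δ M u - densF R S δ M u ≤
        (sizeBound R S M * normBound R S * Real.exp (normBound R S) +
          (1 + (3 + 2 * Hc R S) * (1 + Multiset.card S + Multiset.card R) + M)) * u ^ (-(1 / 2 : ℝ)) := by
  set C5 : ℝ := sizeBound R S M * normBound R S * Real.exp (normBound R S) +
    (1 + (3 + 2 * Hc R S) * (1 + Multiset.card S + Multiset.card R) + M) with hC5
  have hu0 : 0 < u := by linarith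
  set L : ℝ := Real.log u with hLdef
  have hL : 0 < L := Real.log_pos hu
  have htail := hasSum_NF_div_tail (R := R) (S := S) (M := M) hδ hδ1 hL.le
  -- termwise bounds
  have hterm0 : ∀ k : ℕ, 0 ≤ NF R S δ M (L / (k + 2)) / (k + 2) := fun k ↦
    div_nonneg (hpos _ (by positivity)) (by positivity)
  have hterm : ∀ k : ℕ, NF R S δ M (L / (k + 2)) / (k + 2) ≤ C5 * (L * Real.exp (L / 2)) * (1 / ((k : ℝ) + 2) ^ 2) := by
    intro k
    have hk : (0 : ℝ) < k + 2 := by positivity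
    have h1 := NF_le_mul_exp (M := M) hS hR hδ hδ1 (show 0 ≤ L / (k + 2) by positivity)
    have h2 : Real.exp (L / (k + 2)) ≤ Real.exp (L / 2) := by
      refine Real.exp_le_exp.2 (div_le_div_of_nonneg_left hL.le two_pos (by linarith))
    have hB := sizeBound_nonneg (R := R) (S := S) (M := M)
    have hQ := normBound_nonneg (R := R) (S := S)
    have hH := one_le_Hc R S
    have hC5' : 0 ≤ C5 := by positivity
    rw [div_le_iff₀ hk]
    calc NF R S δ M (L / (k + 2)) ≤ C5 * (L / (k + 2) * Real.exp (L / (k + 2))) := h1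
      _ ≤ C5 * (L / (k + 2) * Real.exp (L / 2)) := by gcongr
      _ = C5 * (L * Real.exp (L / 2)) * (1 / ((k : ℝ) + 2) ^ 2) * (k + 2) := by field_simp
  obtain ⟨s, hs1, hs⟩ := hasSum_inv_sq_tail
  have hup : NG R S δ M L - NF R S δ M L ≤ C5 * (L * Real.exp (L / 2)) * s :=
    hasSum_le hterm htail (hs.mul_left _)
  have hlow : 0 ≤ NG R S δ M L - NF R S δ M L := htail.nonneg hterm0
  have hB := sizeBound_nonneg (R := R) (S := S) (M := M)
  have hQ := normBound_nonneg (R := R) (S := S)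
  have hH := one_le_Hc R S
  have hC5' : 0 ≤ C5 := by positivity
  have hup' : NG R S δ M L - NF R S δ M L ≤ C5 * (L * Real.exp (L / 2)) := by
    have h0 : 0 ≤ C5 * (L * Real.exp (L / 2)) := by positivity
    nlinarith
  -- the difference of the densities
  have hdiff : densG R S δ M u - densF R S δ M u = (NG R S δ M L - NF R S δ M L) / (u * L) := by
    rw [densG_of_one_lt hu, densF_of_one_lt hu, ← hLdef, sub_div]
  have hden : 0 < u * L := mul_pos hu0 hL
  rw [hdiff]
  refine ⟨div_nonneg hlow hden.le, ?_⟩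
  rw [div_le_iff₀ hden]
  have hexp : Real.exp (L / 2) = u ^ (1 / 2 : ℝ) := by
    rw [hLdef, Real.rpow_def_of_pos hu0]; ring_nf
  have hpow : u ^ (-(1 / 2 : ℝ)) * u = u ^ (1 / 2 : ℝ) := by
    rw [show (-(1 / 2 : ℝ)) = 1 / 2 - 1 by norm_num, Real.rpow_sub_one hu0.ne']
    field_simp
  calc NG R S δ M L - NF R S δ M L ≤ C5 * (L * Real.exp (L / 2)) := hup'
    _ = C5 * u ^ (-(1 / 2 : ℝ)) * (u * L) := by rw [hexp, ← hpow]; ring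

end BDRMultiset

end Literature.NumberTheory.BeurlingPrimes
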